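import Literature.MathematicalPhysics.QuantumFieldTheory.Balaban1983to89.B3Op116HolderKernelRegularTorus
import Literature.MathematicalPhysics.QuantumFieldTheory.Balaban1983to89.B3Op116CollarCurrency

/-!
# Bałaban, *(Higgs)₂,₃ quantum fields in a finite volume III* [B3] — THE CONSTANTS OF THE (1.16) KERNEL ON THE TORUS ARE UNIFORM IN THE
LATTICE SPACING AND THE SCALE: `valC ≤ valCU`, `derC ≤ derCU`, `holC ≤ holCU` with `valCU / derCU / holCU(d, L, N, C, C_H, δ₁, a, α; σ, τ; M)`
explicit and free of `ε` and `k` — file «KernelCurrencyTorus» (the currency step of the torus value / derivative / Hölder members of (2.5))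

statement-level skeleton of published theorems with citation tags; proofs where landed; nothing here is a claim about the Yang–Mills mass gap

T. Bałaban, Commun. Math. Phys. **88** (1983) 411–445 [cite: Balaban1983Higgs3], (1.16) p. 414, Prop. 1 pp. 420–421, (2.5) p. 424, (2.10)
p. 426; part I [cite: Balaban1982Higgs1], (3.14)–(3.16) pp. 614–615.  PDF held: `paper:balaban1983-higgs-2-3-quantum-fields-finite-volume`
(journal page = PDF page + 410; p. 414 = `p0004.txt`, pp. 420–421 = `p0010.txt`–`p0011.txt`).

CITATION HEADER (lean-in-tree rule).  Cell `lit-balaban` (HOME `run/shared/lean/pub/lit-balaban/`), Phase-2 proof seat **p35** gen 29 (unit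
`lit-balaban-p35`, literature-prover-lit-balaban-p35-g29-0); free-target protocol G.5-34(d) (TAKING HOME/STATUS.md 2026-08-25T05:18Z, own lane:
the displayed constants of the (1.16) kernel are p35's `valC`, `derC`, `holC`), answering the row owner's (r15) record «ε- and k-uniformity NOT typed»
(GAPS G-B3-16.A1 OWNER NOTE 5 (c)) and the declared divergence (ii) of `B3Ineq25Op116RegularRegion` / `B3Ineq25Op116PrintCurrency` for the torus
members.  Model: p40's `B3Op116CollarCurrency.collarK_currency` (Route δ).  SKELETON rows **B3.Eq1.16** / **B3.Eq2.5** (fold owner r15) — located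
members, no head claim.  USED BY NAME, never restated: p35's `B3Op116MajorantStep.{convK, blkK, stepC}`, `B3Op116DKernelRegularTorus.{cK1, kap4,
seqC, rateAt, cvAt, cdAt, valC, derC, seqC_succ, seqC_pos}`, `B3Op116HolderKernelRegularTorus.holC`, p40's `B3Op116CollarCurrency.{pairC₀, blkK₀,
blkK_eq, pairC₀_nonneg}`, the typer's `B1.aSeq_le` / `B1.aSeq_pos`.

## What is printed (verbatim)

[B3] p. 414 [PDF 4]: *"the Hölder norms of the covariant derivatives of this kernel … are exponentially decaying with the distance of the
arguments and are uniformly bounded by O(1)(e(L^kε)^{1−α})^{n+n′}"*.  Prop. 1, pp. 420–421 [PDF 10–11]: *"The constant δ₀ depends on the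
dimension d only … The constant O(1) depends on α₀, n̄ (in fact on n̄ only if α₀ is chosen not too close to 0, e.g. if we take α₀ = ½) and is
independent of ε, k, the domains Ω, Ω₁, Ω₂, the vector field B̃ (if they satisfy the conditions mentioned previously)."*

## What this file proves, and how

The torus theorems `kernel116_value_le` / `kernel116_deriv_le` (`B3Op116DKernelRegularTorus`) and `kernel116_holder_le`
(`B3Op116HolderKernelRegularTorus`) display their constants as explicit recursions `valC`, `derC`, `holC` evaluated AT the lattice (`ε = mesh 0`,
`L^kε = mesh k`) — functions of `ε` and `k` as written (the files say so: «not simplified … cosmetic, not done»).  Here the simplification is DONE: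
§1 the `ε`-free parts `gE₀`, `convK₀` of the one-scale constants (`convK = convK₀·(ε^d)^{−1}`, `blkK = blkK₀` — p40's twin);
§2 **`stepC_currency`**: one step `stepC` of the recursion, multiplied by any normalisation `ν ≥ 0` of its two state slots, is bounded by the
`ε`-FREE, `k`-FREE `stepCU(d, L, N, δ, a_K, a_v, Ĉ, v, w, κ₁, τ, κ₃, K₄)` as soon as `(ε^d)^{−1}c_K ≤ Ĉ`, `νc_v ≤ v`, `νc_d ≤ w`, `L^kε ≤ 1`,
`L^kε·κ₂ ≤ τ`, `L^kε·κ₄ ≤ K₄` (every summand of `stepC` carries exactly one `c_K`, one state slot and one `convK`, so the powers of `ε` cancel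
identically; the value and averaging pairings carry one `L^kε`, which turns `κ₂ = ε^{−1}|e|δ_A` into print's `L^k|e|δ_A` and `κ₄ = kap4` into
`≤ a·dσ(2 + dσ)`, `σ = |e|s` — `mesh_mul_kap4_le`, using `a_k ≤ a`); §3 the dominating recursion **`seqCU`** and **`seqC_currency`**:
`ν·cvAt(J) ≤ (seqCU …).2.1`, `ν·cdAt(J) ≤ (seqCU …).2.2` for every `J`, by induction (`seqCU_rate`: the rates agree); §4 **`valC_currency`**,
**`derC_currency`**, **`holC_currency`**: for `L > 1`, `1 ≤ k`, `L^kε ≤ 1`, `a > 0`, `δ₁ > 0`, `C, C_H, s, δ_A ≥ 0`, `L^k|e|δ_A ≤ τ` and above the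
respective thresholds (`d < M + 2`, `d < M + 1`, `d < 1 + (J+1) − α`, `α < 1`):
`valC(k, a, δ₁, C, s, δ_A; M) ≤ valCU(d, L, N, C, δ₁, a, σ, τ; M)`, `derC ≤ derCU`, `holC(…, ε^dC_H; J) ≤ holCU(d, L, N, C, C_H, δ₁, a, α, σ, τ; J)`
— explicit polynomial recursions in `C`, `C_H`, `σ = |e|s`, `τ`, the geometric factors of `L`, `δ₁`, `a`, `d`, `N`, with NO `ε` and NO `k`: print's
«independent of ε, k» for these members, given print's smallness parameters `|e|s` (the charge times `sup|Ã|`) and `L^k|e|δ_A` (its (I.2.23)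
regularity), exactly the parameters of p40's `collarKU`.

## Honest scope

The hypotheses are the torus files' own plus `L^kε ≤ 1` and a name `τ` for any bound of `L^k|e|δ_A`; the U-constants are upper bounds, not
simplifications to print's literal `O(1)^{n+n′}(e(L^kε)p(L^kε))^{n+n′}` (expressing `σ`, `τ` through `e(L^kε)`, `p(L^kε)` is the regime bookkeeping of
p. 412 / p. 433, and the RATE `δ₁/(4L)^M` is produced after `δ₁` as in the whole (2.5) lineage).  The box / cell-box constants of route γ′
(`valCB`, `derCBθ`, `holCBθ`, `mixCB`) and the torus mixed constant `mixC` are the sequels (`B3Op116KernelCurrencyBox`, `B3Op116MixedCurrency`).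
Definitions are `ε`-free real constants (`gE₀`, `convK₀`, `stepCU`, `kapU`, `seqCU`, `valCU`, `derCU`, `holCU`); no `def … : Prop`, no new named fact,
no `sorry`; axioms standard.  Value = bookkeeping of located members of a by-reference step of B3 — NOT summit progress and nothing about the
Yang–Mills mass gap.
-/

noncomputable section

namespace Literature.MathematicalPhysics.QuantumFieldTheory.Balaban1983to89.B3Op116KernelCurrencyTorus

open HiggsLattice (ChargeData)
open B1Eq230FluctCov (Ix)
open B1Ineq234Concrete (nCol)
open B3Op116MajorantStep (convK blkK stepC)
open B3Op116DKernelRegularTorus (cK1 kap4 seqC rateAt cvAt cdAt valC derC seqC_succ seqC_pos)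
open B3Op116HolderKernelRegularTorus (holC)
open B3Op116CollarCurrency (pairC₀ blkK₀ blkK_eq pairC₀_nonneg)

variable {P : HiggsLattice.Params} {N : ℕ}

/-! ## §1 The `ε`-free parts of the one-scale constants -/

section EpsFree

/-- the geometric constant of the finer-scale sums, `L^e/(L^e − 1)`, as a function of the real `L`. [cite: Balaban1983Higgs3, (2.6) p.424] -/
def gE₀ (L e : ℝ) : ℝ := L ^ e / (L ^ e - 1)

/-- `gE₀ ≥ 0` for `L ≥ 1`, `e ≥ 0` (at `e = 0` it is `1/0 = 0`). [cite: Balaban1983Higgs3, (2.6) p.424] -/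
theorem gE₀_nonneg {L : ℝ} (hL : 1 ≤ L) {e : ℝ} (he : 0 ≤ e) : 0 ≤ gE₀ L e := by
  have h1 : 1 ≤ L ^ e := Real.one_le_rpow hL he
  unfold gE₀
  exact div_nonneg (by linarith) (by linarith)

/-- `convK₀(d, L, N, δ, a₁, a₂) = N_col(8d/δ)^d·(L^{a₁}/(L^{a₁}−1) + L^{a₂}/(L^{a₂}−1))`, the `ε`-free part of the convolution constant
(`convK = convK₀·(ε^d)^{−1}`). [cite: Balaban1983Higgs3, (2.6) p.424, (2.10) p.426] -/
def convK₀ (d : ℕ) (L : ℝ) (N : ℕ) (δ a₁ a₂ : ℝ) : ℝ := pairC₀ d N δ * (gE₀ L a₁ + gE₀ L a₂)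

/-- `convK₀ ≥ 0` for `L ≥ 1`, `δ > 0`, `a₁, a₂ ≥ 0`. [cite: Balaban1983Higgs3, (2.10) p.426] -/
theorem convK₀_nonneg {d : ℕ} {L : ℝ} (hL : 1 ≤ L) (N : ℕ) {δ a₁ a₂ : ℝ} (hδ : 0 < δ) (ha₁ : 0 ≤ a₁) (ha₂ : 0 ≤ a₂) :
    0 ≤ convK₀ d L N δ a₁ a₂ :=
  mul_nonneg (pairC₀_nonneg d N hδ) (add_nonneg (gE₀_nonneg hL ha₁) (gE₀_nonneg hL ha₂))

/-- `convK = convK₀·(ε^d)^{−1}` (definitional). [cite: Balaban1983Higgs3, (2.10) p.426] -/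
theorem convK_eq (δ a₁ a₂ : ℝ) : convK P N δ a₁ a₂ = convK₀ P.d (P.L : ℝ) N δ a₁ a₂ * (P.mesh 0 ^ P.d)⁻¹ := by
  unfold convK convK₀ pairC₀ gE₀
  ring

/-- `blkK₀(d, L, …) ≥ 0` for any real `L > 1`, `δ > 0`, `a > 0` (the `P`-free form of `blkK_nonneg`). [cite: Balaban1983Higgs3, (2.10) p.426] -/
theorem blkK₀_nonneg' {d : ℕ} {L : ℝ} (hL : 1 < L) (N : ℕ) {δ a : ℝ} (hδ : 0 < δ) (ha : 0 < a) : 0 ≤ blkK₀ d L N δ a := by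
  have h1 : 0 < L ^ a - 1 := by have := Real.one_lt_rpow hL ha; linarith
  have h2 : 0 ≤ (4 * (d : ℝ) / (δ / 2)) ^ d := pow_nonneg (by positivity) _
  unfold blkK₀
  positivity

/-- `L^kε·(ε⁻¹·x) = L^k·x`: one power of the scale converts print's `ε⁻¹|e|δ_A` into `L^k|e|δ_A`. [cite: Balaban1982Higgs1, (2.23) p.610] -/
theorem mesh_mul_inv_mesh_zero_mul (k : ℕ) (x : ℝ) : P.mesh k * ((P.mesh 0)⁻¹ * x) = (P.L : ℝ) ^ k * x := by
  have hε : P.ε ≠ 0 := P.hε.ne'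
  unfold HiggsLattice.Params.mesh
  rw [pow_zero, one_mul]
  field_simp

/-- `ε ≤ L^kε` (`L ≥ 1`). [cite: Balaban1982Higgs1, (1.19) p.607] -/
theorem mesh_zero_le_mesh (k : ℕ) : P.mesh 0 ≤ P.mesh k := by
  have hL1 : (1 : ℝ) ≤ (P.L : ℝ) := by exact_mod_cast P.hL
  have h1 : (1 : ℝ) ≤ (P.L : ℝ) ^ k := one_le_pow₀ hL1
  unfold HiggsLattice.Params.mesh
  rw [pow_zero, one_mul]
  nlinarith [P.hε]

/-- print's averaging coefficient times one power of the scale is uniform: `L^kε·κ₄ ≤ a·dσ(2 + dσ)`, `σ = |e|s` (`κ₄ = |a_k|(L^kε)^{−2}m(2+m)`,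
`m = |e|sε·d(L^k − 1) ≤ dσ·L^kε`, `a_k ≤ a`, `L^kε ≤ 1`). [cite: Balaban1982Higgs1, (3.15)–(3.16) pp.614–615] -/
theorem mesh_mul_kap4_le (hL : 1 < P.L) {C : ChargeData N} {k : ℕ} (hk : 1 ≤ k) (hmesh : P.mesh k ≤ 1) {a s : ℝ} (ha : 0 < a)
    (hs : 0 ≤ s) : P.mesh k * kap4 P C k a s ≤ a * ((P.d : ℝ) * (|C.e| * s) * (2 + (P.d : ℝ) * (|C.e| * s))) := by
  have hL1 : (1 : ℝ) < (P.L : ℝ) := by exact_mod_cast hL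
  have hM : 0 < P.mesh k := P.mesh_pos k
  have hσ : 0 ≤ |C.e| * s := mul_nonneg (abs_nonneg _) hs
  have hd : (0 : ℝ) ≤ (P.d : ℝ) := Nat.cast_nonneg _
  -- the small parameter `m = dσ(L^kε − ε)`
  have hm_eq : |C.e| * s * P.mesh 0 * ((P.d : ℝ) * ((P.L : ℝ) ^ k - 1)) = (P.d : ℝ) * (|C.e| * s) * (P.mesh k - P.mesh 0) := by
    unfold HiggsLattice.Params.mesh; rw [pow_zero, one_mul]; ring
  have hm0 : 0 ≤ (P.d : ℝ) * (|C.e| * s) * (P.mesh k - P.mesh 0) :=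
    mul_nonneg (mul_nonneg hd hσ) (by linarith [mesh_zero_le_mesh (P := P) k])
  have hm1 : (P.d : ℝ) * (|C.e| * s) * (P.mesh k - P.mesh 0) ≤ (P.d : ℝ) * (|C.e| * s) * P.mesh k :=
    mul_le_mul_of_nonneg_left (by linarith [P.mesh_pos 0]) (mul_nonneg hd hσ)
  have hak : |B1.aSeq a (P.L : ℝ) k| ≤ a := by
    rw [abs_of_pos (B1.aSeq_pos ha hL1 hk)]; exact B1.aSeq_le ha hL1 k hk
  have hak0 : 0 ≤ |B1.aSeq a (P.L : ℝ) k| := abs_nonneg _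
  set m : ℝ := (P.d : ℝ) * (|C.e| * s) * (P.mesh k - P.mesh 0) with hm
  have hid : P.mesh k * kap4 P C k a s = |B1.aSeq a (P.L : ℝ) k| * ((P.mesh k)⁻¹ * m) * (2 + m) := by
    unfold kap4; rw [hm_eq]; field_simp
  have h2 : (P.mesh k)⁻¹ * m ≤ (P.d : ℝ) * (|C.e| * s) := by
    rw [inv_mul_le_iff₀ hM]; linarith
  have h2' : 0 ≤ (P.mesh k)⁻¹ * m := mul_nonneg (inv_nonneg.mpr hM.le) hm0
  have h3 : 2 + m ≤ 2 + (P.d : ℝ) * (|C.e| * s) := by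
    have : (P.d : ℝ) * (|C.e| * s) * P.mesh k ≤ (P.d : ℝ) * (|C.e| * s) * 1 := mul_le_mul_of_nonneg_left hmesh (mul_nonneg hd hσ)
    linarith
  have h3' : 0 ≤ 2 + m := by linarith
  rw [hid]
  calc |B1.aSeq a (P.L : ℝ) k| * ((P.mesh k)⁻¹ * m) * (2 + m)
      ≤ a * ((P.d : ℝ) * (|C.e| * s)) * (2 + (P.d : ℝ) * (|C.e| * s)) :=
        mul_le_mul (mul_le_mul hak h2 h2' ha.le) h3 h3' (mul_nonneg ha.le (mul_nonneg hd hσ))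
    _ = a * ((P.d : ℝ) * (|C.e| * s) * (2 + (P.d : ℝ) * (|C.e| * s))) := by ring

/-- the differentiated-column constant is `ε^d` times a uniform one: `(ε^d)^{−1}·cK1 ≤ C(1 + e|e|s)` (`L^kε ≤ 1`). [cite: Balaban1983Higgs3, (2.10) p.426] -/
theorem inv_mul_cK1_le {C : ChargeData N} {k : ℕ} (hmesh : P.mesh k ≤ 1) {Cst s : ℝ} (hCst : 0 ≤ Cst) (hs : 0 ≤ s) :
    (P.mesh 0 ^ P.d)⁻¹ * cK1 P C k Cst s ≤ Cst * (1 + Real.exp 1 * (|C.e| * s)) := by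
  have hE : P.mesh 0 ^ P.d ≠ 0 := (pow_pos (P.mesh_pos 0) _).ne'
  have hσ : 0 ≤ Real.exp 1 * (|C.e| * s) := mul_nonneg (Real.exp_nonneg _) (mul_nonneg (abs_nonneg _) hs)
  have hid : (P.mesh 0 ^ P.d)⁻¹ * cK1 P C k Cst s = Cst * (1 + Real.exp 1 * (|C.e| * s) * P.mesh k) := by
    unfold cK1; field_simp
  rw [hid]
  refine mul_le_mul_of_nonneg_left ?_ hCst
  nlinarith [P.mesh_pos k]

/-- `(ε^d)^{−1}·(ε^dC) = C`. [cite: Balaban1983Higgs3, (2.10) p.426] -/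
theorem inv_mul_cK2_eq (Cst : ℝ) : (P.mesh 0 ^ P.d)⁻¹ * (P.mesh 0 ^ P.d * Cst) = Cst := by
  have hE : P.mesh 0 ^ P.d ≠ 0 := (pow_pos (P.mesh_pos 0) _).ne'
  field_simp

end EpsFree

/-! ## §2 One step of the recursion in uniform currency -/

section Step

/-- **the uniform twin of `stepC`**: `stepC` with every power of `ε` multiplied out — `c_K ↦ Ĉ = (ε^d)^{−1}c_K`, state slots `c_v ↦ v = νc_v`,
`c_d ↦ w = νc_d`, `convK ↦ convK₀`, `blkK ↦ blkK₀`, and the one power of the scale of the value/averaging pairings spent on `κ₂ ↦ τ`, `κ₃ ↦ κ₃`,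
`κ₄ ↦ K₄`.  A function of `d, L, N` and real parameters only: no `ε`, no `k`. [cite: Balaban1983Higgs3, (1.16) p.414, Prop. 1 pp.420–421, (2.10) p.426] -/
def stepCU (d : ℕ) (L : ℝ) (N : ℕ) (δ aK av Ĉ v w κ₁ τ κ₃ K₄ : ℝ) : ℝ :=
  (d : ℝ) * (κ₁ * (Real.exp 1 * Ĉ * w * convK₀ d L N δ aK (av - 1)) + κ₁ * (Ĉ * w * convK₀ d L N δ aK (av - 1)))
    + ((d : ℝ) * (τ * (Ĉ * v * convK₀ d L N δ aK av) + κ₃ * (Real.exp 1 * Ĉ * (Real.exp 1 * v) * convK₀ d L N δ aK av))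
      + K₄ * (Ĉ * (blkK₀ d L N δ av * v * L ^ (av - (d : ℝ))) * convK₀ d L N (δ / 2 / L) aK av))

/-- `stepCU ≥ 0` (`L > 1`, `δ > 0`, `a_K > 0`, `a_v > 1`, parameters `≥ 0`). [cite: Balaban1983Higgs3, (2.10) p.426] -/
theorem stepCU_nonneg {d : ℕ} {L : ℝ} (hL : 1 < L) (N : ℕ) {δ aK av Ĉ v w κ₁ τ κ₃ K₄ : ℝ} (hδ : 0 < δ) (haK : 0 < aK) (hav : 1 < av)
    (hĈ : 0 ≤ Ĉ) (hv : 0 ≤ v) (hw : 0 ≤ w) (hκ₁ : 0 ≤ κ₁) (hτ : 0 ≤ τ) (hκ₃ : 0 ≤ κ₃) (hK₄ : 0 ≤ K₄) :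
    0 ≤ stepCU d L N δ aK av Ĉ v w κ₁ τ κ₃ K₄ := by
  have hL0 : 0 < L := by linarith
  have hK1 : 0 ≤ convK₀ d L N δ aK (av - 1) := convK₀_nonneg hL.le N hδ haK.le (by linarith)
  have hK2 : 0 ≤ convK₀ d L N δ aK av := convK₀_nonneg hL.le N hδ haK.le (by linarith)
  have hK3 : 0 ≤ convK₀ d L N (δ / 2 / L) aK av := convK₀_nonneg hL.le N (by positivity) haK.le (by linarith)
  have hb : 0 ≤ blkK₀ d L N δ av := blkK₀_nonneg' hL N hδ (by linarith)
  have hLp : 0 ≤ L ^ (av - (d : ℝ)) := Real.rpow_nonneg hL0.le _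
  have he : 0 ≤ Real.exp 1 := Real.exp_nonneg _
  unfold stepCU
  positivity

/-- monotonicity of a product of three nonnegative factors against a fixed nonnegative multiplier (the shape of every summand below; folklore analysis). [cite: Balaban1983Higgs3, (2.10) p.426] -/
private theorem prod3_le {a b c a' b' c' m : ℝ} (ha : 0 ≤ a) (hb : 0 ≤ b) (hc : 0 ≤ c) (hm : 0 ≤ m)
    (ha' : a ≤ a') (hb' : b ≤ b') (hc' : c ≤ c') : a * (b * c) * m ≤ a' * (b' * c') * m := by
  have hbc : b * c ≤ b' * c' := mul_le_mul hb' hc' hc (hb.trans hb')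
  exact mul_le_mul_of_nonneg_right (mul_le_mul ha' hbc (mul_nonneg hb hc) (ha.trans ha')) hm

/-- **ONE STEP IN UNIFORM CURRENCY.**  For `L > 1`, `L^kε ≤ 1`, `δ > 0`, `a_K > 0`, `a_v > 1`, any normalisation `ν ≥ 0` of the two state slots and
nonnegative inputs with `(ε^d)^{−1}c_K ≤ Ĉ`, `νc_v ≤ v`, `νc_d ≤ w`, `L^kε·κ₂ ≤ τ`, `L^kε·κ₄ ≤ K₄`:
`ν·stepC(k; δ, a_K, a_v, c_K, c_v, c_d, κ₁, κ₂, κ₃, κ₄) ≤ stepCU(d, L, N; δ, a_K, a_v, Ĉ, v, w, κ₁, τ, κ₃, K₄)` — every summand of `stepC` carries one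
`c_K`, one state slot and one `convK = convK₀·(ε^d)^{−1}`, so the powers of `ε` cancel identically; the pairings that carry `L^kε` pay it to
`κ₂`, `κ₃ ≤ κ₃`, `κ₄`. [cite: Balaban1983Higgs3, (1.16) p.414, Prop. 1 pp.420–421, (2.10) p.426] -/
theorem stepC_currency (hL : 1 < P.L) {k : ℕ} (hmesh : P.mesh k ≤ 1) {δ aK av : ℝ} (hδ : 0 < δ) (haK : 0 < aK) (hav : 1 < av)
    {ν cK cv cd Ĉ v w κ₁ κ₂ κ₃ κ₄ τ K₄ : ℝ} (hν : 0 ≤ ν) (hcK : 0 ≤ cK) (hĈ : (P.mesh 0 ^ P.d)⁻¹ * cK ≤ Ĉ)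
    (hcv : 0 ≤ cv) (hv : ν * cv ≤ v) (hcd : 0 ≤ cd) (hw : ν * cd ≤ w)
    (hκ₁ : 0 ≤ κ₁) (hκ₂ : 0 ≤ κ₂) (hτ : P.mesh k * κ₂ ≤ τ) (hκ₃ : 0 ≤ κ₃) (hκ₄ : 0 ≤ κ₄) (hK₄ : P.mesh k * κ₄ ≤ K₄) :
    ν * stepC P N k δ aK av cK cv cd κ₁ κ₂ κ₃ κ₄ ≤ stepCU P.d (P.L : ℝ) N δ aK av Ĉ v w κ₁ τ κ₃ K₄ := by
  have hL1 : (1 : ℝ) < (P.L : ℝ) := by exact_mod_cast hL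
  have hL0 : (0 : ℝ) < (P.L : ℝ) := by linarith
  have hd : (0 : ℝ) ≤ (P.d : ℝ) := Nat.cast_nonneg _
  have he : 0 ≤ Real.exp 1 := Real.exp_nonneg _
  have hE : 0 ≤ (P.mesh 0 ^ P.d)⁻¹ := inv_nonneg.mpr (pow_nonneg (P.mesh_pos 0).le _)
  have hM : 0 ≤ P.mesh k := (P.mesh_pos k).le
  have hK1 : 0 ≤ convK₀ P.d (P.L : ℝ) N δ aK (av - 1) := convK₀_nonneg hL1.le N hδ haK.le (by linarith)
  have hK2 : 0 ≤ convK₀ P.d (P.L : ℝ) N δ aK av := convK₀_nonneg hL1.le N hδ haK.le (by linarith)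
  have hK3 : 0 ≤ convK₀ P.d (P.L : ℝ) N (δ / 2 / (P.L : ℝ)) aK av := convK₀_nonneg hL1.le N (by positivity) haK.le (by linarith)
  have hb : 0 ≤ blkK₀ P.d (P.L : ℝ) N δ av := blkK₀_nonneg' hL1 N hδ (by linarith)
  have hLp : 0 ≤ (P.L : ℝ) ^ (av - (P.d : ℝ)) := Real.rpow_nonneg hL0.le _
  -- the three normalised slots
  have hX0 : 0 ≤ (P.mesh 0 ^ P.d)⁻¹ * cK := mul_nonneg hE hcK
  have hY0 : 0 ≤ ν * cv := mul_nonneg hν hcv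
  have hZ0 : 0 ≤ ν * cd := mul_nonneg hν hcd
  have h2 : 0 ≤ P.mesh k * κ₂ := mul_nonneg hM hκ₂
  have h3 : P.mesh k * κ₃ ≤ κ₃ := by nlinarith
  have h3' : 0 ≤ P.mesh k * κ₃ := mul_nonneg hM hκ₃
  have h4 : 0 ≤ P.mesh k * κ₄ := mul_nonneg hM hκ₄
  -- the identity: every summand = (slot) · (slot) · (ε-free multiplier)
  have hid : ν * stepC P N k δ aK av cK cv cd κ₁ κ₂ κ₃ κ₄ =
      1 * (((P.mesh 0 ^ P.d)⁻¹ * cK) * (ν * cd)) * ((P.d : ℝ) * κ₁ * (Real.exp 1 + 1) * convK₀ P.d (P.L : ℝ) N δ aK (av - 1))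
      + (P.mesh k * κ₂) * (((P.mesh 0 ^ P.d)⁻¹ * cK) * (ν * cv)) * ((P.d : ℝ) * convK₀ P.d (P.L : ℝ) N δ aK av)
      + (P.mesh k * κ₃) * (((P.mesh 0 ^ P.d)⁻¹ * cK) * (ν * cv)) * ((P.d : ℝ) * (Real.exp 1 * Real.exp 1) * convK₀ P.d (P.L : ℝ) N δ aK av)
      + (P.mesh k * κ₄) * (((P.mesh 0 ^ P.d)⁻¹ * cK) * (ν * cv)) *
          (blkK₀ P.d (P.L : ℝ) N δ av * (P.L : ℝ) ^ (av - (P.d : ℝ)) * convK₀ P.d (P.L : ℝ) N (δ / 2 / (P.L : ℝ)) aK av) := by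
    unfold stepC
    rw [convK_eq, convK_eq, convK_eq, blkK_eq]
    ring
  have hU : stepCU P.d (P.L : ℝ) N δ aK av Ĉ v w κ₁ τ κ₃ K₄ =
      1 * (Ĉ * w) * ((P.d : ℝ) * κ₁ * (Real.exp 1 + 1) * convK₀ P.d (P.L : ℝ) N δ aK (av - 1))
      + τ * (Ĉ * v) * ((P.d : ℝ) * convK₀ P.d (P.L : ℝ) N δ aK av)
      + κ₃ * (Ĉ * v) * ((P.d : ℝ) * (Real.exp 1 * Real.exp 1) * convK₀ P.d (P.L : ℝ) N δ aK av)
      + K₄ * (Ĉ * v) * (blkK₀ P.d (P.L : ℝ) N δ av * (P.L : ℝ) ^ (av - (P.d : ℝ)) * convK₀ P.d (P.L : ℝ) N (δ / 2 / (P.L : ℝ)) aK av) := by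
    unfold stepCU
    ring
  rw [hid, hU]
  refine add_le_add (add_le_add (add_le_add ?_ ?_) ?_) ?_
  · exact prod3_le zero_le_one hX0 hZ0 (by positivity) le_rfl hĈ hw
  · exact prod3_le h2 hX0 hY0 (by positivity) hτ hĈ hv
  · exact prod3_le h3' hX0 hY0 (by positivity) h3 hĈ hv
  · exact prod3_le h4 hX0 hY0 (by positivity) hK₄ hĈ hv

end Step

/-! ## §3 The dominating recursion -/

section Recursion

/-- **the uniform twin of the recursion `seqC`**: the same rate component, and `stepCU` in place of `stepC` with the column constants `Ĉ₂`
(value column) and `Ĉ₁` (differentiated column). [cite: Balaban1983Higgs3, (1.16) p.414, Prop. 1 pp.420–421] -/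
def seqCU (d : ℕ) (L : ℝ) (N : ℕ) (Ĉ2 Ĉ1 κ₁ τ κ₃ K₄ δ₀ v₀ w₀ : ℝ) : ℕ → ℝ × ℝ × ℝ
  | 0 => (δ₀, v₀, w₀)
  | J + 1 =>
    ((seqCU d L N Ĉ2 Ĉ1 κ₁ τ κ₃ K₄ δ₀ v₀ w₀ J).1 / 2 / L / 2,
      stepCU d L N (seqCU d L N Ĉ2 Ĉ1 κ₁ τ κ₃ K₄ δ₀ v₀ w₀ J).1 2 (2 + (J : ℝ)) Ĉ2
        (seqCU d L N Ĉ2 Ĉ1 κ₁ τ κ₃ K₄ δ₀ v₀ w₀ J).2.1 (seqCU d L N Ĉ2 Ĉ1 κ₁ τ κ₃ K₄ δ₀ v₀ w₀ J).2.2 κ₁ τ κ₃ K₄,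
      stepCU d L N (seqCU d L N Ĉ2 Ĉ1 κ₁ τ κ₃ K₄ δ₀ v₀ w₀ J).1 1 (2 + (J : ℝ)) Ĉ1
        (seqCU d L N Ĉ2 Ĉ1 κ₁ τ κ₃ K₄ δ₀ v₀ w₀ J).2.1 (seqCU d L N Ĉ2 Ĉ1 κ₁ τ κ₃ K₄ δ₀ v₀ w₀ J).2.2 κ₁ τ κ₃ K₄)

/-- print's averaging combination `K₄(d, a, σ) = a·dσ(2 + dσ)` (the uniform bound of `L^kε·κ₄`, `mesh_mul_kap4_le`). [cite: Balaban1982Higgs1, (3.16) p.615] -/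
def kapU (d : ℕ) (a σ : ℝ) : ℝ := a * ((d : ℝ) * σ * (2 + (d : ℝ) * σ))

/-- `K₄ ≥ 0` (`a, σ ≥ 0`). [cite: Balaban1982Higgs1, (3.16) p.615] -/
theorem kapU_nonneg (d : ℕ) {a σ : ℝ} (ha : 0 ≤ a) (hσ : 0 ≤ σ) : 0 ≤ kapU d a σ := by
  unfold kapU; positivity

variable {C : ChargeData N} {k : ℕ} {a Cst s δA δ₀ cv₀ cd₀ : ℝ}

/-- the rate components of `seqC` and `seqCU` agree (both are `δ₀/(4L)^J`). [cite: Balaban1983Higgs3, (2.10) p.426] -/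
theorem seqCU_rate (Ĉ2 Ĉ1 κ₁ τ κ₃ K₄ v₀ w₀ : ℝ) (J : ℕ) :
    (seqCU P.d (P.L : ℝ) N Ĉ2 Ĉ1 κ₁ τ κ₃ K₄ δ₀ v₀ w₀ J).1 = rateAt P N C k a Cst s δA δ₀ cv₀ cd₀ J := by
  induction J with
  | zero => rfl
  | succ J ih =>
    rw [(seqC_succ (P := P) (N := N) (C := C) (k := k) (a := a) (Cst := Cst) (s := s) (δA := δA) (δ₀ := δ₀) (cv₀ := cv₀)
      (cd₀ := cd₀) J).1, ← ih]
    rfl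

/-- positivity along `seqCU` (`L > 1`, `δ₀ > 0`, seeds and parameters `≥ 0`). [cite: Balaban1983Higgs3, (2.10) p.426] -/
theorem seqCU_nonneg {d : ℕ} {L : ℝ} (hL : 1 < L) {Ĉ2 Ĉ1 κ₁ τ κ₃ K₄ δ₀ v₀ w₀ : ℝ} (hδ₀ : 0 < δ₀) (hĈ2 : 0 ≤ Ĉ2) (hĈ1 : 0 ≤ Ĉ1)
    (hκ₁ : 0 ≤ κ₁) (hτ : 0 ≤ τ) (hκ₃ : 0 ≤ κ₃) (hK₄ : 0 ≤ K₄) (hv₀ : 0 ≤ v₀) (hw₀ : 0 ≤ w₀) (J : ℕ) :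
    0 < (seqCU d L N Ĉ2 Ĉ1 κ₁ τ κ₃ K₄ δ₀ v₀ w₀ J).1 ∧ 0 ≤ (seqCU d L N Ĉ2 Ĉ1 κ₁ τ κ₃ K₄ δ₀ v₀ w₀ J).2.1 ∧
      0 ≤ (seqCU d L N Ĉ2 Ĉ1 κ₁ τ κ₃ K₄ δ₀ v₀ w₀ J).2.2 := by
  have hL0 : 0 < L := by linarith
  induction J with
  | zero => exact ⟨hδ₀, hv₀, hw₀⟩
  | succ J ih =>
    obtain ⟨h1, h2, h3⟩ := ih
    have hJ : (1 : ℝ) < 2 + (J : ℝ) := by have := (Nat.cast_nonneg J : (0 : ℝ) ≤ J); linarith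
    refine ⟨?_, ?_, ?_⟩
    · show 0 < (seqCU d L N Ĉ2 Ĉ1 κ₁ τ κ₃ K₄ δ₀ v₀ w₀ J).1 / 2 / L / 2; positivity
    · exact stepCU_nonneg hL N h1 (by norm_num) hJ hĈ2 h2 h3 hκ₁ hτ hκ₃ hK₄
    · exact stepCU_nonneg hL N h1 (by norm_num) hJ hĈ1 h2 h3 hκ₁ hτ hκ₃ hK₄

/-- **THE RECURSION IN UNIFORM CURRENCY.**  On a lattice with `L > 1`, `1 ≤ k`, `L^kε ≤ 1`, for `a > 0`, `C, s, δ_A ≥ 0`, `δ₀ > 0`, seeds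
`c_{v,0}, c_{d,0} ≥ 0` and any normalisation `ν ≥ 0` with `νc_{v,0} ≤ v₀`, `νc_{d,0} ≤ w₀`, and any `τ ≥ L^k|e|δ_A`: for every `J`,
`ν·cvAt(J) ≤ (seqCU(d, L, N, C, C(1+e|e|s), |e|s, τ, (|e|s)², K₄(d,a,|e|s), δ₀, v₀, w₀) J).2.1` and `ν·cdAt(J) ≤ (…).2.2` — the displayed value and
derivative constants of every state of the (1.16) induction are `ε^d/ν`… times quantities bounded uniformly in `ε` and `k`.
[cite: Balaban1983Higgs3, (1.16) p.414, Prop. 1 pp.420–421, (2.10) p.426] -/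
theorem seqC_currency (hL : 1 < P.L) (hk : 1 ≤ k) (hmesh : P.mesh k ≤ 1) (ha : 0 < a) (hCst : 0 ≤ Cst) (hs : 0 ≤ s) (hδA : 0 ≤ δA)
    (hδ₀ : 0 < δ₀) (hcv₀ : 0 ≤ cv₀) (hcd₀ : 0 ≤ cd₀) {ν v₀ w₀ τ : ℝ} (hν : 0 ≤ ν) (hv₀ : ν * cv₀ ≤ v₀) (hw₀ : ν * cd₀ ≤ w₀)
    (hτ : (P.L : ℝ) ^ k * (|C.e| * δA) ≤ τ) (J : ℕ) :
    ν * cvAt P N C k a Cst s δA δ₀ cv₀ cd₀ J ≤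
        (seqCU P.d (P.L : ℝ) N Cst (Cst * (1 + Real.exp 1 * (|C.e| * s))) (|C.e| * s) τ ((|C.e| * s) ^ 2) (kapU P.d a (|C.e| * s))
          δ₀ v₀ w₀ J).2.1 ∧
      ν * cdAt P N C k a Cst s δA δ₀ cv₀ cd₀ J ≤
        (seqCU P.d (P.L : ℝ) N Cst (Cst * (1 + Real.exp 1 * (|C.e| * s))) (|C.e| * s) τ ((|C.e| * s) ^ 2) (kapU P.d a (|C.e| * s))
          δ₀ v₀ w₀ J).2.2 := by
  have hσ : 0 ≤ |C.e| * s := mul_nonneg (abs_nonneg _) hs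
  have hκ₂ : 0 ≤ (P.mesh 0)⁻¹ * (|C.e| * δA) := mul_nonneg (inv_nonneg.mpr (P.mesh_pos 0).le) (mul_nonneg (abs_nonneg _) hδA)
  have hτ' : P.mesh k * ((P.mesh 0)⁻¹ * (|C.e| * δA)) ≤ τ := by rw [mesh_mul_inv_mesh_zero_mul]; exact hτ
  have hκ₄ : 0 ≤ kap4 P C k a s := B3Op116DKernelRegularTorus.kap4_nonneg hs
  have hK₄ : P.mesh k * kap4 P C k a s ≤ kapU P.d a (|C.e| * s) := mesh_mul_kap4_le hL hk hmesh ha hs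
  have hc2 : 0 ≤ P.mesh 0 ^ P.d * Cst := mul_nonneg (pow_nonneg (P.mesh_pos 0).le _) hCst
  have hĈ2 : (P.mesh 0 ^ P.d)⁻¹ * (P.mesh 0 ^ P.d * Cst) ≤ Cst := (inv_mul_cK2_eq (P := P) Cst).le
  obtain ⟨-, hc1⟩ := B3Op116DKernelRegularTorus.cK1_ge (P := P) (C := C) (k := k) hCst hs
  have hĈ1 : (P.mesh 0 ^ P.d)⁻¹ * cK1 P C k Cst s ≤ Cst * (1 + Real.exp 1 * (|C.e| * s)) := inv_mul_cK1_le hmesh hCst hs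
  induction J with
  | zero => exact ⟨hv₀, hw₀⟩
  | succ J ih =>
    obtain ⟨ihv, ihd⟩ := ih
    obtain ⟨hr0, -, hcvJ, hcdJ⟩ := seqC_pos (P := P) (N := N) (C := C) (k := k) (a := a) (Cst := Cst) (s := s) (δA := δA) (δ₀ := δ₀)
      (cv₀ := cv₀) (cd₀ := cd₀) (δ₁ := δ₀) hL hδ₀ le_rfl hcv₀ hcd₀ hCst hs hδA J
    obtain ⟨-, e2, e3⟩ := seqC_succ (P := P) (N := N) (C := C) (k := k) (a := a) (Cst := Cst) (s := s) (δA := δA) (δ₀ := δ₀)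
      (cv₀ := cv₀) (cd₀ := cd₀) J
    have hJ : (1 : ℝ) < 2 + (J : ℝ) := by have := (Nat.cast_nonneg J : (0 : ℝ) ≤ J); linarith
    have hrate := seqCU_rate (P := P) (N := N) (C := C) (k := k) (a := a) (Cst := Cst) (s := s) (δA := δA) (δ₀ := δ₀) (cv₀ := cv₀)
      (cd₀ := cd₀) Cst (Cst * (1 + Real.exp 1 * (|C.e| * s))) (|C.e| * s) τ ((|C.e| * s) ^ 2) (kapU P.d a (|C.e| * s)) v₀ w₀ J
    constructor
    · show ν * cvAt P N C k a Cst s δA δ₀ cv₀ cd₀ (J + 1) ≤ stepCU P.d (P.L : ℝ) N _ 2 (2 + (J : ℝ)) Cst _ _ _ _ _ _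
      rw [e2, hrate]
      exact stepC_currency hL hmesh hr0 (by norm_num) hJ hν hc2 hĈ2 hcvJ ihv hcdJ ihd hσ hκ₂ hτ' (sq_nonneg _) hκ₄ hK₄
    · show ν * cdAt P N C k a Cst s δA δ₀ cv₀ cd₀ (J + 1) ≤ stepCU P.d (P.L : ℝ) N _ 1 (2 + (J : ℝ)) _ _ _ _ _ _ _
      rw [e3, hrate]
      exact stepC_currency hL hmesh hr0 (by norm_num) hJ hν hc1 hĈ1 hcvJ ihv hcdJ ihd hσ hκ₂ hτ' (sq_nonneg _) hκ₄ hK₄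

end Recursion

/-! ## §4 The displayed constants of the torus theorems are uniform in `ε` and `k` -/

section Kernel

/-- the uniform recursion at the unit seeds `(δ₁; C, C(1+e σ))` of the torus theorems. [cite: Balaban1983Higgs3, (1.16) p.414, (2.10) p.426] -/
def seqCU₁ (d : ℕ) (L : ℝ) (N : ℕ) (Cst δ₁ a σ τ : ℝ) : ℕ → ℝ × ℝ × ℝ :=
  seqCU d L N Cst (Cst * (1 + Real.exp 1 * σ)) σ τ (σ ^ 2) (kapU d a σ) δ₁ Cst (Cst * (1 + Real.exp 1 * σ))

/-- **the uniform value constant** `valCU(d, L, N, C, δ₁, a, σ, τ; M) = #Ix·(seqCU₁ … M).2.1/(L^{2+M−d} − 1)` — NO `ε`, NO `k`.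
[cite: Balaban1983Higgs3, (1.16) p.414, Prop. 1 pp.420–421] -/
def valCU (d : ℕ) (L : ℝ) (N : ℕ) (Cst δ₁ a σ τ : ℝ) (M : ℕ) : ℝ :=
  (Fintype.card (Ix N) : ℝ) * ((seqCU₁ d L N Cst δ₁ a σ τ M).2.1 / (L ^ ((2 : ℝ) + (M : ℝ) - (d : ℝ)) - 1))

/-- **the uniform derivative constant** `derCU(…; M) = #Ix·(seqCU₁ … M).2.2/(L^{1+M−d} − 1)`. [cite: Balaban1983Higgs3, (1.16) p.414, Prop. 1 pp.420–421] -/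
def derCU (d : ℕ) (L : ℝ) (N : ℕ) (Cst δ₁ a σ τ : ℝ) (M : ℕ) : ℝ :=
  (Fintype.card (Ix N) : ℝ) * ((seqCU₁ d L N Cst δ₁ a σ τ M).2.2 / (L ^ ((1 : ℝ) + (M : ℝ) - (d : ℝ)) - 1))

/-- **the uniform Hölder constant** `holCU(…, C_H, α; J) = 2·#Ix·stepCU(δ_J, 1−α, 2+J, C_H, state J of seqCU₁)/(L^{1+(J+1)−α−d} − 1)`.
[cite: Balaban1983Higgs3, (1.16) p.414, Prop. 1 pp.420–421, (2.11) p.426] -/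
def holCU (d : ℕ) (L : ℝ) (N : ℕ) (Cst CH δ₁ a α σ τ : ℝ) (J : ℕ) : ℝ :=
  2 * ((Fintype.card (Ix N) : ℝ) *
    (stepCU d L N (seqCU₁ d L N Cst δ₁ a σ τ J).1 (1 - α) (2 + (J : ℝ)) CH (seqCU₁ d L N Cst δ₁ a σ τ J).2.1
        (seqCU₁ d L N Cst δ₁ a σ τ J).2.2 σ τ (σ ^ 2) (kapU d a σ)
      / (L ^ ((1 : ℝ) + ((J + 1 : ℕ) : ℝ) - α - (d : ℝ)) - 1)))

variable {C : ChargeData N} {k : ℕ} {a δ₁ Cst s δA τ : ℝ}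

/-- **THE VALUE CONSTANT OF (1.16) ON THE TORUS IS UNIFORM IN `ε` AND `k`**: for `L > 1`, `1 ≤ k`, `L^kε ≤ 1`, `a > 0`, `δ₁ > 0`, `C, s, δ_A ≥ 0`,
`L^k|e|δ_A ≤ τ` and `d < M + 2`: `valC(k, a, δ₁, C, s, δ_A; M) ≤ valCU(d, L, N, C, δ₁, a, |e|s, τ; M)` — the constant `C_V` of p40's binder `hV`
(`kernel116_value_le`) may be taken independent of the lattice spacing and of the scale, as Prop. 1 states.
[cite: Balaban1983Higgs3, (1.16) p.414, Prop. 1 pp.420–421, (2.5) p.424] -/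
theorem valC_currency (hL : 1 < P.L) (hk : 1 ≤ k) (hmesh : P.mesh k ≤ 1) (ha : 0 < a) (hδ₁ : 0 < δ₁) (hCst : 0 ≤ Cst) (hs : 0 ≤ s)
    (hδA : 0 ≤ δA) (hτ : (P.L : ℝ) ^ k * (|C.e| * δA) ≤ τ) (M : ℕ) (hd : (P.d : ℝ) < (M : ℝ) + 2) :
    valC P N C k a δ₁ Cst s δA M ≤ valCU P.d (P.L : ℝ) N Cst δ₁ a (|C.e| * s) τ M := by
  have hL1 : (1 : ℝ) < (P.L : ℝ) := by exact_mod_cast hL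
  have hE : 0 ≤ (P.mesh 0 ^ P.d)⁻¹ := inv_nonneg.mpr (pow_nonneg (P.mesh_pos 0).le _)
  have hc2 : 0 ≤ P.mesh 0 ^ P.d * Cst := mul_nonneg (pow_nonneg (P.mesh_pos 0).le _) hCst
  obtain ⟨-, hc1⟩ := B3Op116DKernelRegularTorus.cK1_ge (P := P) (C := C) (k := k) hCst hs
  have hD : 0 < (P.L : ℝ) ^ ((2 : ℝ) + (M : ℝ) - (P.d : ℝ)) - 1 := by
    have := Real.one_lt_rpow hL1 (show (0 : ℝ) < 2 + (M : ℝ) - (P.d : ℝ) by linarith); linarith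
  have h := (seqC_currency (δ₀ := δ₁) (cv₀ := P.mesh 0 ^ P.d * Cst) (cd₀ := cK1 P C k Cst s) hL hk hmesh ha hCst hs hδA hδ₁ hc2 hc1 hE
    (inv_mul_cK2_eq (P := P) Cst).le (inv_mul_cK1_le hmesh hCst hs) hτ M).1
  unfold valC valCU seqCU₁
  rw [show (P.mesh 0 ^ P.d)⁻¹ * (Fintype.card (Ix N) : ℝ) *
      (cvAt P N C k a Cst s δA δ₁ (P.mesh 0 ^ P.d * Cst) (cK1 P C k Cst s) M / ((P.L : ℝ) ^ ((2 : ℝ) + (M : ℝ) - (P.d : ℝ)) - 1))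
      = (Fintype.card (Ix N) : ℝ) * (((P.mesh 0 ^ P.d)⁻¹ * cvAt P N C k a Cst s δA δ₁ (P.mesh 0 ^ P.d * Cst) (cK1 P C k Cst s) M)
          / ((P.L : ℝ) ^ ((2 : ℝ) + (M : ℝ) - (P.d : ℝ)) - 1)) by ring]
  exact mul_le_mul_of_nonneg_left (div_le_div_of_nonneg_right h hD.le) (Nat.cast_nonneg _)

/-- **THE DERIVATIVE CONSTANT OF (1.16) ON THE TORUS IS UNIFORM IN `ε` AND `k`** (`d < M + 1`): `derC(…; M) ≤ derCU(d, L, N, C, δ₁, a, |e|s, τ; M)`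
— the constant `C_D` of p40's binder `hDv` (`kernel116_deriv_le`). [cite: Balaban1983Higgs3, (1.16) p.414, Prop. 1 pp.420–421, (2.5) p.424] -/
theorem derC_currency (hL : 1 < P.L) (hk : 1 ≤ k) (hmesh : P.mesh k ≤ 1) (ha : 0 < a) (hδ₁ : 0 < δ₁) (hCst : 0 ≤ Cst) (hs : 0 ≤ s)
    (hδA : 0 ≤ δA) (hτ : (P.L : ℝ) ^ k * (|C.e| * δA) ≤ τ) (M : ℕ) (hd : (P.d : ℝ) < (M : ℝ) + 1) :
    derC P N C k a δ₁ Cst s δA M ≤ derCU P.d (P.L : ℝ) N Cst δ₁ a (|C.e| * s) τ M := by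
  have hL1 : (1 : ℝ) < (P.L : ℝ) := by exact_mod_cast hL
  have hE : 0 ≤ (P.mesh 0 ^ P.d)⁻¹ := inv_nonneg.mpr (pow_nonneg (P.mesh_pos 0).le _)
  have hc2 : 0 ≤ P.mesh 0 ^ P.d * Cst := mul_nonneg (pow_nonneg (P.mesh_pos 0).le _) hCst
  obtain ⟨-, hc1⟩ := B3Op116DKernelRegularTorus.cK1_ge (P := P) (C := C) (k := k) hCst hs
  have hD : 0 < (P.L : ℝ) ^ ((1 : ℝ) + (M : ℝ) - (P.d : ℝ)) - 1 := by
    have := Real.one_lt_rpow hL1 (show (0 : ℝ) < 1 + (M : ℝ) - (P.d : ℝ) by linarith); linarith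
  have h := (seqC_currency (δ₀ := δ₁) (cv₀ := P.mesh 0 ^ P.d * Cst) (cd₀ := cK1 P C k Cst s) hL hk hmesh ha hCst hs hδA hδ₁ hc2 hc1 hE
    (inv_mul_cK2_eq (P := P) Cst).le (inv_mul_cK1_le hmesh hCst hs) hτ M).2
  unfold derC derCU seqCU₁
  rw [show (P.mesh 0 ^ P.d)⁻¹ * (Fintype.card (Ix N) : ℝ) *
      (cdAt P N C k a Cst s δA δ₁ (P.mesh 0 ^ P.d * Cst) (cK1 P C k Cst s) M / ((P.L : ℝ) ^ ((1 : ℝ) + (M : ℝ) - (P.d : ℝ)) - 1))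
      = (Fintype.card (Ix N) : ℝ) * (((P.mesh 0 ^ P.d)⁻¹ * cdAt P N C k a Cst s δA δ₁ (P.mesh 0 ^ P.d * Cst) (cK1 P C k Cst s) M)
          / ((P.L : ℝ) ^ ((1 : ℝ) + (M : ℝ) - (P.d : ℝ)) - 1)) by ring]
  exact mul_le_mul_of_nonneg_left (div_le_div_of_nonneg_right h hD.le) (Nat.cast_nonneg _)

/-- **THE HÖLDER CONSTANT OF (1.16) ON THE TORUS IS UNIFORM IN `ε` AND `k`**: with the (2.11) Hölder column constant of the form `ε^dC_H`
(`B3Op116BoxRows.hcol_le_univ`), `C_H ≥ 0`, `α < 1` and `d < 1 + (J+1) − α`: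
`holC(k, a, δ₁, C, s, δ_A, α, ε^dC_H; J) ≤ holCU(d, L, N, C, C_H, δ₁, a, α, |e|s, τ; J)` — the constant `C_H` of p40's binder `hH`
(`kernel116_holder_le`). [cite: Balaban1983Higgs3, (1.16) p.414, Prop. 1 pp.420–421, (2.5) p.424, (2.11) p.426] -/
theorem holC_currency (hL : 1 < P.L) (hk : 1 ≤ k) (hmesh : P.mesh k ≤ 1) (ha : 0 < a) (hδ₁ : 0 < δ₁) (hCst : 0 ≤ Cst) (hs : 0 ≤ s)
    (hδA : 0 ≤ δA) (hτ : (P.L : ℝ) ^ k * (|C.e| * δA) ≤ τ) {α CH : ℝ} (hα1 : α < 1) (hCH : 0 ≤ CH) (J : ℕ)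
    (hd : (P.d : ℝ) < 1 + ((J + 1 : ℕ) : ℝ) - α) :
    holC P N C k a δ₁ Cst s δA α (P.mesh 0 ^ P.d * CH) J ≤ holCU P.d (P.L : ℝ) N Cst CH δ₁ a α (|C.e| * s) τ J := by
  have hL1 : (1 : ℝ) < (P.L : ℝ) := by exact_mod_cast hL
  have hE : 0 ≤ (P.mesh 0 ^ P.d)⁻¹ := inv_nonneg.mpr (pow_nonneg (P.mesh_pos 0).le _)
  have hc2 : 0 ≤ P.mesh 0 ^ P.d * Cst := mul_nonneg (pow_nonneg (P.mesh_pos 0).le _) hCst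
  have hcH : 0 ≤ P.mesh 0 ^ P.d * CH := mul_nonneg (pow_nonneg (P.mesh_pos 0).le _) hCH
  obtain ⟨-, hc1⟩ := B3Op116DKernelRegularTorus.cK1_ge (P := P) (C := C) (k := k) hCst hs
  have hσ : 0 ≤ |C.e| * s := mul_nonneg (abs_nonneg _) hs
  have hκ₂ : 0 ≤ (P.mesh 0)⁻¹ * (|C.e| * δA) := mul_nonneg (inv_nonneg.mpr (P.mesh_pos 0).le) (mul_nonneg (abs_nonneg _) hδA)
  have hτ' : P.mesh k * ((P.mesh 0)⁻¹ * (|C.e| * δA)) ≤ τ := by rw [mesh_mul_inv_mesh_zero_mul]; exact hτ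
  have hκ₄ : 0 ≤ kap4 P C k a s := B3Op116DKernelRegularTorus.kap4_nonneg hs
  have hK₄ : P.mesh k * kap4 P C k a s ≤ kapU P.d a (|C.e| * s) := mesh_mul_kap4_le hL hk hmesh ha hs
  have hD : 0 < (P.L : ℝ) ^ ((1 : ℝ) + ((J + 1 : ℕ) : ℝ) - α - (P.d : ℝ)) - 1 := by
    have := Real.one_lt_rpow hL1 (show (0 : ℝ) < 1 + ((J + 1 : ℕ) : ℝ) - α - (P.d : ℝ) by linarith); linarith
  obtain ⟨hv, hw⟩ := seqC_currency (δ₀ := δ₁) (cv₀ := P.mesh 0 ^ P.d * Cst) (cd₀ := cK1 P C k Cst s) hL hk hmesh ha hCst hs hδA hδ₁ hc2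
    hc1 hE (inv_mul_cK2_eq (P := P) Cst).le (inv_mul_cK1_le hmesh hCst hs) hτ J
  obtain ⟨hr0, -, hcvJ, hcdJ⟩ := seqC_pos (P := P) (N := N) (C := C) (k := k) (a := a) (Cst := Cst) (s := s) (δA := δA) (δ₀ := δ₁)
    (cv₀ := P.mesh 0 ^ P.d * Cst) (cd₀ := cK1 P C k Cst s) (δ₁ := δ₁) hL hδ₁ le_rfl hc2 hc1 hCst hs hδA J
  have hJ : (1 : ℝ) < 2 + (J : ℝ) := by have := (Nat.cast_nonneg J : (0 : ℝ) ≤ J); linarith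
  have hstep := stepC_currency (N := N) (aK := 1 - α) hL hmesh hr0 (by linarith) hJ hE hcH (inv_mul_cK2_eq (P := P) CH).le hcvJ hv hcdJ hw
    hσ hκ₂ hτ' (sq_nonneg (|C.e| * s)) hκ₄ hK₄
  unfold holC holCU seqCU₁
  rw [seqCU_rate (P := P) (N := N) (C := C) (k := k) (a := a) (Cst := Cst) (s := s) (δA := δA) (δ₀ := δ₁)
    (cv₀ := P.mesh 0 ^ P.d * Cst) (cd₀ := cK1 P C k Cst s)]
  have key : ∀ S : ℝ, 2 * ((P.mesh 0 ^ P.d)⁻¹ * (Fintype.card (Ix N) : ℝ) *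
      (S / ((P.L : ℝ) ^ ((1 : ℝ) + ((J + 1 : ℕ) : ℝ) - α - (P.d : ℝ)) - 1)))
      = 2 * ((Fintype.card (Ix N) : ℝ) * (((P.mesh 0 ^ P.d)⁻¹ * S) / ((P.L : ℝ) ^ ((1 : ℝ) + ((J + 1 : ℕ) : ℝ) - α - (P.d : ℝ)) - 1))) :=
    fun S => by ring
  rw [key]
  exact mul_le_mul_of_nonneg_left (mul_le_mul_of_nonneg_left (div_le_div_of_nonneg_right hstep hD.le) (Nat.cast_nonneg _))
    (by norm_num)

end Kernel

end Literature.MathematicalPhysics.QuantumFieldTheory.Balaban1983to89.B3Op116KernelCurrencyTorus
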